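import Summits.KontsevichZagierPeriods.KontsevichZagierPeriods.Theorems.RootDecompRationalCubeDichotomyRankDescentP06

/-! # `RootDecompRationalCubeDichotomyRankDescentP07` — part 7/14 of the mechanical ≤400-line split of `RankDescent_v12_landing.lean` (sha256 00885b8b9882f02e…)
Source: decomp-kz lens-2 g13 `RankDescent_v12.lean` (HOME/decomp-kz-lens-2/g13/, sha256 00885b8b…; critic g5-18…g5-66 CLEARED as NODE v1–v12 for crux stmt-KontsevichZagierPeriods-26322 RationalCubePiKernelSingle: rank dichotomy single_of_fullRankGeTwo + RankLeOneKernel, de Rham-exact descent, linear-in-one-variable / hyperbola / Fermat–hyperbolic / conic classes, transport kit, Brieskorn module; writer g7 l.1222: «landing split §0–4 ∣ … ∣ §16 --supports 26322 endorsed»); `#print axioms` pins removed; landed by census-1 g9.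
Split by census-1 g9 `gen/splitlean.py`: scopes re-opened with their `open`/`variable`/`set_option` context; mathematics and declaration order unchanged. -/

noncomputable section
open MeasureTheory Set MvPolynomial
open Literature.NumberTheory.Transcendental
open Literature.NumberTheory.Transcendental.KZ
namespace Summit.KontsevichZagierPeriods.RootDecompRationalCubeDichotomy.Rung26322.RankDescent
variable {M : ℕ}
open MeasureTheory Set MvPolynomial in
open Literature.NumberTheory.Transcendental in
open Literature.NumberTheory.Transcendental.KZ in
/-- `∂_k`-antiderivatives exist in `ℚ[x]`. [folklore] -/
private theorem exists_pderiv_eq (k : Fin M) (P : MvPolynomial (Fin M) ℚ) :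
    ∃ G : MvPolynomial (Fin M) ℚ, pderiv k G = P := by
  have hv : (Pi.single k (1:ℚ) : Fin M → ℚ) ≠ 0 := by
    intro h
    have := congrFun h k
    simp at this
  obtain ⟨G, hG⟩ := exists_dirD_eq (Pi.single k (1:ℚ)) hv P
  refine ⟨G, ?_⟩
  have hs : (∑ j, (Pi.single k (1:ℚ) : Fin M → ℚ) j • (pderiv j G : MvPolynomial (Fin M) ℚ)) = pderiv k G := by
    rw [Finset.sum_eq_single k (fun j _ hj => by simp [hj])
      (fun h => (h (Finset.mem_univ k)).elim)]
    simp
  rw [dirD_apply, hs] at hG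
  exact hG

section FermatHyperbolic
variable {n : ℕ}

/-- Auxiliary step `mem_ex0m_iff`: mem ex0m iff. [bookkeeping] -/
theorem mem_ex0m_iff {Q P : MvPolynomial (Fin n) ℚ} :
    P ∈ Ex0m Q ↔ ∃ G : Fin n → MvPolynomial (Fin n) ℚ, P * Q = ∑ k, exS Q k (G k) := Iff.rfl

/-- Auxiliary step `drExact_of_ex0m`: dr Exact of ex0m. [bookkeeping] -/
theorem drExact_of_ex0m {Q P : MvPolynomial (Fin n) ℚ} (h : P ∈ Ex0m Q) : DRExact P Q := by
  obtain ⟨G, hG⟩ := mem_ex0m_iff.mp h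
  refine ⟨0, G, ?_⟩
  rw [sum_exS_eq, ← hG, zero_add, pow_one]

/-- Auxiliary step `mul_mem_ex0m`: mul mem ex0m. [bookkeeping] -/
theorem mul_mem_ex0m (Q R : MvPolynomial (Fin (n + 1)) ℚ) : Q * R ∈ Ex0m Q := by
  obtain ⟨Φ, hΦ⟩ := exists_pderiv_eq (0 : Fin (n + 1)) R
  refine mem_ex0m_iff.mpr ⟨(Pi.single 0 (Φ * Q) : Fin (n + 1) → MvPolynomial (Fin (n + 1)) ℚ), ?_⟩
  rw [sum_exS_single]
  simp only [exS, Derivation.leibniz, smul_eq_mul, hΦ, Nat.cast_zero, zero_add, map_one, one_mul]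
  ring

/-- The all-ones exponent vector and the product monomial `u = x₀⋯x_{n-1}`. [folklore] -/
def ones (n : ℕ) : Fin n →₀ ℕ := ∑ i, Finsupp.single i 1

/-- Auxiliary step `ones_apply`: ones apply. [bookkeeping] -/
theorem ones_apply (k : Fin n) : ones n k = 1 := by
  simp [ones, Finsupp.finsetSum_apply, Finsupp.single_apply]

/-- `u = monomial 𝟙 1 = ∏ x_i`. [folklore] -/
theorem monomial_ones_eq_prod : (monomial (ones n) (1 : ℚ) : MvPolynomial (Fin n) ℚ) = ∏ i, X i := by
  rw [monomial_eq, Finsupp.prod_pow, map_one, one_mul]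
  exact Finset.prod_congr rfl fun i _ => by rw [ones_apply, pow_one]

/-- `Q = q₀ + x₀⋯x_{n-1}`. [folklore] -/
def fhQ (n : ℕ) (q₀ : ℚ) : MvPolynomial (Fin n) ℚ := C q₀ + monomial (ones n) 1

/-- Auxiliary step `fhQ_eq`: fh Q eq. [bookkeeping] -/
theorem fhQ_eq (q₀ : ℚ) : fhQ n q₀ = C q₀ + ∏ i, X i := by rw [fhQ, monomial_ones_eq_prod]

/-- Euler on a monomial against `Q`: `S_j(x_j x^d) = x^d·(q₀ + d_j·Q)`. [folklore] -/
theorem exS_X_mul_monomial (q₀ : ℚ) (d : Fin n →₀ ℕ) (a : ℚ) (j : Fin n) :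
    exS (fhQ n q₀) j (X j * monomial d a)
      = monomial d a * C q₀ + C ((d j : ℕ) : ℚ) * (monomial d a * fhQ n q₀) := by
  have h1 : X j * pderiv j (monomial d a) = C ((d j : ℕ) : ℚ) * monomial d a := by
    rw [X_mul_pderiv_monomial, ← Nat.cast_smul_eq_nsmul ℚ, smul_eq_C_mul]
  have h2 : X j * pderiv j (fhQ n q₀) = monomial (ones n) 1 := by
    rw [fhQ, map_add, pderiv_C, zero_add, X_mul_pderiv_monomial, ones_apply, one_smul]
  have h3 : X j * monomial d a * pderiv j (fhQ n q₀) = monomial d a * (X j * pderiv j (fhQ n q₀)) := by ring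
  simp only [exS, Derivation.leibniz, smul_eq_mul, pderiv_X_self, mul_one, Nat.cast_zero, zero_add, map_one,
    one_mul, h3, h2]
  have h4 : (X j * pderiv j (monomial d a) + monomial d a) * fhQ n q₀
      = (C ((d j : ℕ) : ℚ) * monomial d a + monomial d a) * fhQ n q₀ := by rw [h1]
  rw [add_mul, fhQ] at h4 ⊢
  rw [show X j * (pderiv j) (monomial d a) * (C q₀ + monomial (ones n) 1)
      = C ((d j : ℕ) : ℚ) * monomial d a * (C q₀ + monomial (ones n) 1) by
        rw [h1]]
  ring

/-- **Monomials with non-constant exponent vector are exact** over `q₀ + x₀⋯x_{n-1}`. [folklore] -/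
theorem monomial_mem_ex0m (q₀ : ℚ) (d : Fin n →₀ ℕ) (a : ℚ) (k l : Fin n) (hkl : d k ≠ d l) :
    (monomial d a : MvPolynomial (Fin n) ℚ) ∈ Ex0m (fhQ n q₀) := by
  -- weights α_k = 1/(d_k − d_l), α_l = −1/(d_k − d_l), others 0
  set δ : ℚ := ((d k : ℕ) : ℚ) - ((d l : ℕ) : ℚ) with hδ
  have hδ0 : δ ≠ 0 := sub_ne_zero.mpr (by exact_mod_cast hkl)
  have hkl' : k ≠ l := fun h => hkl (by rw [h])
  let α : Fin n → ℚ := fun j => if j = k then δ⁻¹ else if j = l then -δ⁻¹ else 0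
  have hα0 : ∑ j, α j = 0 := by
    have : ∀ j, α j = (if j = k then δ⁻¹ else 0) + (if j = l then -δ⁻¹ else 0) := by
      intro j; simp only [α]; split_ifs with h1 h2 <;> simp_all
    simp_rw [this, Finset.sum_add_distrib, Finset.sum_ite_eq', Finset.mem_univ, if_true]
    ring
  have hα1 : ∑ j, α j * ((d j : ℕ) : ℚ) = 1 := by
    have : ∀ j, α j * ((d j : ℕ) : ℚ)
        = (if j = k then δ⁻¹ * ((d k : ℕ) : ℚ) else 0) + (if j = l then -δ⁻¹ * ((d l : ℕ) : ℚ) else 0) := by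
      intro j; simp only [α]; split_ifs with h1 h2 <;> simp_all
    simp_rw [this, Finset.sum_add_distrib, Finset.sum_ite_eq', Finset.mem_univ, if_true]
    rw [hδ] at hδ0 ⊢
    field_simp
    ring
  refine mem_ex0m_iff.mpr ⟨fun j => α j • (X j * monomial d a), ?_⟩
  simp_rw [exS_smul, exS_X_mul_monomial, smul_add, smul_eq_C_mul, Finset.sum_add_distrib, ← Finset.sum_mul,
    ← mul_assoc, ← Finset.sum_mul, ← map_mul, ← map_sum, hα0, hα1, map_zero, map_one, zero_mul, one_mul, zero_add]

/-- `u^i − (−q₀)^i` is a multiple of `Q`. [folklore] -/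
theorem exists_U_pow_sub (q₀ : ℚ) (i : ℕ) :
    ∃ R : MvPolynomial (Fin n) ℚ, (monomial (ones n) (1 : ℚ)) ^ i - C ((-q₀) ^ i) = fhQ n q₀ * R := by
  obtain ⟨R, hR⟩ := sub_dvd_pow_sub_pow (monomial (ones n) (1 : ℚ) : MvPolynomial (Fin n) ℚ) (C (-q₀)) i
  refine ⟨R, ?_⟩
  rw [map_pow, hR, fhQ, map_neg]
  ring

/-- Auxiliary step `U_pow_sub_C_mem`: U pow sub C mem. [bookkeeping] -/
theorem U_pow_sub_C_mem (q₀ : ℚ) (i : ℕ) :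
    ((monomial (ones (n + 1)) (1 : ℚ)) ^ i - C ((-q₀) ^ i) : MvPolynomial (Fin (n + 1)) ℚ) ∈ Ex0m (fhQ (n + 1) q₀) := by
  obtain ⟨R, hR⟩ := exists_U_pow_sub q₀ i
  rw [hR]
  exact mul_mem_ex0m _ _

/-- Summand of the pure-diagonal functional. [folklore] -/
def diagFnm (q₀ : ℚ) (d : Fin (n + 1) →₀ ℕ) (a : ℚ) : ℚ :=
  if d = d 0 • ones (n + 1) then a * (-q₀) ^ (d 0) else 0

/-- **The pure-diagonal functional** `diagAltm q₀ (Σ p_d x^d) = Σ_i p_{(i,…,i)} (−q₀)^i`. [folklore] -/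
def diagAltm (q₀ : ℚ) (P : MvPolynomial (Fin (n + 1)) ℚ) : ℚ := (AddMonoidAlgebra.coeff P).sum (diagFnm q₀)

/-- Auxiliary step `diagAltm_monomial`: diag Altm monomial. [bookkeeping] -/
theorem diagAltm_monomial (q₀ : ℚ) (d : Fin (n + 1) →₀ ℕ) (a : ℚ) :
    diagAltm q₀ (monomial d a) = diagFnm q₀ d a :=
  sum_monomial_eq (by simp [diagFnm])

/-- Auxiliary step `diagAltm_add`: diag Altm add. [bookkeeping] -/
theorem diagAltm_add (q₀ : ℚ) (P P' : MvPolynomial (Fin (n + 1)) ℚ) :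
    diagAltm q₀ (P + P') = diagAltm q₀ P + diagAltm q₀ P' := by
  unfold diagAltm
  rw [AddMonoidAlgebra.coeff_add]
  exact Finsupp.sum_add_index' (fun d => by simp [diagFnm]) (fun d b₁ b₂ => by
    unfold diagFnm; split_ifs <;> ring)

/-- Auxiliary step `diagAltm_smul`: diag Altm smul. [bookkeeping] -/
theorem diagAltm_smul (q₀ c : ℚ) (P : MvPolynomial (Fin (n + 1)) ℚ) :
    diagAltm q₀ (c • P) = c * diagAltm q₀ P := by
  unfold diagAltm
  rw [AddMonoidAlgebra.coeff_smul, Finsupp.sum_smul_index' (fun d => by simp [diagFnm]), Finsupp.mul_sum]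
  apply Finsupp.sum_congr
  intro d _
  unfold diagFnm
  split_ifs <;> simp [smul_eq_mul, mul_assoc]

/-- Auxiliary step `diagAltm_C`: diag Altm C. [bookkeeping] -/
theorem diagAltm_C (q₀ a : ℚ) : diagAltm (n := n) q₀ (C a) = a := by
  rw [← monomial_zero', diagAltm_monomial]
  simp [diagFnm]

/-- Auxiliary step `diagAltm_U_pow`: diag Altm U pow. [bookkeeping] -/
theorem diagAltm_U_pow (q₀ : ℚ) (i : ℕ) :
    diagAltm q₀ ((monomial (ones (n + 1)) (1 : ℚ)) ^ i) = (-q₀) ^ i := by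
  rw [monomial_pow, one_pow, diagAltm_monomial]
  simp [diagFnm, ones_apply]

/-- Off-diagonal monomials have functional `0`. [folklore] -/
theorem diagAltm_monomial_of_ne (q₀ : ℚ) (d : Fin (n + 1) →₀ ℕ) (a : ℚ) (k l : Fin (n + 1)) (hkl : d k ≠ d l) :
    diagAltm q₀ (monomial d a) = 0 := by
  rw [diagAltm_monomial, diagFnm, if_neg]
  intro h
  apply hkl
  have hk := congrArg (fun f : Fin (n + 1) →₀ ℕ => f k) h
  have hl := congrArg (fun f : Fin (n + 1) →₀ ℕ => f l) h
  simp only [Finsupp.smul_apply, ones_apply, smul_eq_mul, mul_one] at hk hl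
  rw [hk, hl]

/-- **Every numerator is congruent to its functional modulo exact ones** over `q₀ + x₀⋯x_n`. [folklore] -/
theorem sub_C_diagAltm_mem (q₀ : ℚ) (P : MvPolynomial (Fin (n + 1)) ℚ) :
    P - C (diagAltm q₀ P) ∈ Ex0m (fhQ (n + 1) q₀) := by
  induction P using MvPolynomial.induction_on' with
  | monomial d a =>
    rw [diagAltm_monomial]
    by_cases hd : d = d 0 • ones (n + 1)
    · have hval : diagFnm q₀ d a = a * (-q₀) ^ (d 0) := by rw [diagFnm, if_pos hd]
      have hmon : (monomial d a : MvPolynomial (Fin (n + 1)) ℚ) = a • (monomial (ones (n + 1)) (1 : ℚ)) ^ (d 0) := by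
        rw [monomial_pow, one_pow, smul_monomial, smul_eq_mul, mul_one, ← hd]
      have key : (a • (monomial (ones (n + 1)) (1 : ℚ)) ^ (d 0) - C (a * (-q₀) ^ (d 0)) : MvPolynomial (Fin (n + 1)) ℚ)
          = a • ((monomial (ones (n + 1)) (1 : ℚ)) ^ (d 0) - C ((-q₀) ^ (d 0))) := by
        rw [smul_eq_C_mul, smul_eq_C_mul, map_mul]
        ring
      rw [hval, hmon, key]
      exact Submodule.smul_mem _ _ (U_pow_sub_C_mem q₀ _)
    · have hne : ∃ k, d k ≠ d 0 := by
        by_contra h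
        push Not at h
        apply hd
        ext k
        simp [ones_apply, h k]
      obtain ⟨k, hk⟩ := hne
      simp only [diagFnm, if_neg hd, map_zero, sub_zero]
      exact monomial_mem_ex0m q₀ d a k 0 hk
  | add p q hp hq =>
    have : p + q - C (diagAltm q₀ (p + q)) = (p - C (diagAltm q₀ p)) + (q - C (diagAltm q₀ q)) := by
      rw [diagAltm_add, map_add]; ring
    rw [this]
    exact add_mem hp hq

/-- **Numerators with vanishing pure-diagonal functional are exact over `q₀ + x₀⋯x_n`.** [folklore] -/
theorem drExact_fermatHyperbolic (q₀ : ℚ) (P : MvPolynomial (Fin (n + 1)) ℚ) (h : diagAltm q₀ P = 0) :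
    DRExact P (C q₀ + ∏ i, X i) := by
  have := sub_C_diagAltm_mem q₀ P
  rw [h, map_zero, sub_zero, fhQ_eq] at this
  exact drExact_of_ex0m this

/-- **One-step reduction, every dimension**: `[ [0,1]^{n+1}, P/(q₀ + x₀⋯x_n) ]` with vanishing functional and value 0
satisfies 26322's conclusion as soon as `SingleAt n` holds. [cite: KontsevichZagier2001, §1.2] -/
theorem fermatHyperbolic_single_of_singleAt (ih : SingleAt n) (q₀ : ℚ) (q : IntegralRep (n + 1))
    (P : MvPolynomial (Fin (n + 1)) ℚ) (hP : diagAltm q₀ P = 0)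
    (hd : q.domain = Set.pi Set.univ (fun _ : Fin (n + 1) => Set.Icc (0:ℝ) 1))
    (hQ : ∀ z ∈ Set.pi Set.univ (fun _ : Fin (n + 1) => Set.Icc (0:ℝ) 1),
      MvPolynomial.aeval z (C q₀ + ∏ i, X i : MvPolynomial (Fin (n + 1)) ℚ) ≠ 0)
    (hf : ∀ z ∈ Set.pi Set.univ (fun _ : Fin (n + 1) => Set.Icc (0:ℝ) 1),
      q.integrand z = MvPolynomial.aeval z P / MvPolynomial.aeval z (C q₀ + ∏ i, X i : MvPolynomial (Fin (n + 1)) ℚ))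
    (h0 : q.value = 0) : ∃ N : ℕ, (fun y : FormalRep => of piRep * y)^[N] (of q) ∈ relations := by
  obtain ⟨s, G, hid⟩ := drExact_fermatHyperbolic q₀ P hP
  exact single_of_exact ih q P _ s G hid hd hQ hf h0

/-- **DECIDED (m = 2, N = 0)** — second route to §8: `[ [0,1]², P/(q₀ + xy) ]`, pure-diagonal functional `0`. [cite: KontsevichZagier2001, §1.2] -/
theorem fermatHyperbolic_two_mem_relations (q₀ : ℚ) (q : IntegralRep 2) (P : MvPolynomial (Fin 2) ℚ)
    (hP : diagAltm q₀ P = 0)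
    (hd : q.domain = Set.pi Set.univ (fun _ : Fin 2 => Set.Icc (0:ℝ) 1))
    (hQ : ∀ z ∈ Set.pi Set.univ (fun _ : Fin 2 => Set.Icc (0:ℝ) 1),
      MvPolynomial.aeval z (C q₀ + ∏ i, X i : MvPolynomial (Fin 2) ℚ) ≠ 0)
    (hf : ∀ z ∈ Set.pi Set.univ (fun _ : Fin 2 => Set.Icc (0:ℝ) 1),
      q.integrand z = MvPolynomial.aeval z P / MvPolynomial.aeval z (C q₀ + ∏ i, X i : MvPolynomial (Fin 2) ℚ))
    (h0 : q.value = 0) : of q ∈ relations := by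
  obtain ⟨s, G, hid⟩ := drExact_fermatHyperbolic q₀ P hP
  exact mem_relations_of_exact_two q P _ s G hid hd hQ hf h0

/-- **m = 3, the `ζ(3)` denominator** `q₀ + xyz` (`∫∫∫ dxdydz/(1+xyz) = (3/4)ζ(3)`): numerators with
`Σ_k p_kkk (−q₀)^k = 0` and value 0 satisfy 26322's conclusion GIVEN `DimTwoRationalStratum` (item 0096). [cite: KontsevichZagier2001, §1.2] -/
theorem fermatHyperbolic_three_of_dimTwo
    (h2 : Summit.KontsevichZagierPeriods.KontsevichZagierPeriods.Theses.HodgeLevel.DimTwoRationalStratum)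
    (q₀ : ℚ) (q : IntegralRep 3) (P : MvPolynomial (Fin 3) ℚ) (hP : diagAltm q₀ P = 0)
    (hd : q.domain = Set.pi Set.univ (fun _ : Fin 3 => Set.Icc (0:ℝ) 1))
    (hQ : ∀ z ∈ Set.pi Set.univ (fun _ : Fin 3 => Set.Icc (0:ℝ) 1),
      MvPolynomial.aeval z (C q₀ + ∏ i, X i : MvPolynomial (Fin 3) ℚ) ≠ 0)
    (hf : ∀ z ∈ Set.pi Set.univ (fun _ : Fin 3 => Set.Icc (0:ℝ) 1),
      q.integrand z = MvPolynomial.aeval z P / MvPolynomial.aeval z (C q₀ + ∏ i, X i : MvPolynomial (Fin 3) ℚ))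
    (h0 : q.value = 0) : ∃ N : ℕ, (fun y : FormalRep => of piRep * y)^[N] (of q) ∈ relations :=
  fermatHyperbolic_single_of_singleAt (singleAt_of_dimTwoRationalStratum h2 le_rfl) q₀ q P hP hd hQ hf h0

/-- The residual of 26322 on `q₀ + x₀⋯x_n`: pure-diagonal functional NON-ZERO (one parameter per denominator;
generator value `η(n+1) = (1 − 2^{−n})ζ(n+1)` for `q₀ = 1`). [folklore] -/
def FermatHyperbolicResidual (n : ℕ) (q₀ : ℚ) : Prop :=
  ∀ (q : IntegralRep (n + 1)) (P : MvPolynomial (Fin (n + 1)) ℚ), diagAltm q₀ P ≠ 0 →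
    q.domain = Set.pi Set.univ (fun _ : Fin (n + 1) => Set.Icc (0:ℝ) 1) →
    (∀ z ∈ Set.pi Set.univ (fun _ : Fin (n + 1) => Set.Icc (0:ℝ) 1),
      MvPolynomial.aeval z (C q₀ + ∏ i, X i : MvPolynomial (Fin (n + 1)) ℚ) ≠ 0) →
    (∀ z ∈ Set.pi Set.univ (fun _ : Fin (n + 1) => Set.Icc (0:ℝ) 1),
      q.integrand z = MvPolynomial.aeval z P / MvPolynomial.aeval z (C q₀ + ∏ i, X i : MvPolynomial (Fin (n + 1)) ℚ)) →
    q.value = 0 → ∃ N : ℕ, (fun y : FormalRep => of piRep * y)^[N] (of q) ∈ relations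

/-- **26322 on `q₀ + x₀⋯x_n` ⟸ `SingleAt n` ∧ its one-parameter residual (PROVED split, every dimension).** [folklore] -/
theorem fermatHyperbolic_single_of_residual (ih : SingleAt n) (q₀ : ℚ) (h : FermatHyperbolicResidual n q₀)
    (q : IntegralRep (n + 1)) (P : MvPolynomial (Fin (n + 1)) ℚ)
    (hd : q.domain = Set.pi Set.univ (fun _ : Fin (n + 1) => Set.Icc (0:ℝ) 1))
    (hQ : ∀ z ∈ Set.pi Set.univ (fun _ : Fin (n + 1) => Set.Icc (0:ℝ) 1),
      MvPolynomial.aeval z (C q₀ + ∏ i, X i : MvPolynomial (Fin (n + 1)) ℚ) ≠ 0)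
    (hf : ∀ z ∈ Set.pi Set.univ (fun _ : Fin (n + 1) => Set.Icc (0:ℝ) 1),
      q.integrand z = MvPolynomial.aeval z P / MvPolynomial.aeval z (C q₀ + ∏ i, X i : MvPolynomial (Fin (n + 1)) ℚ))
    (h0 : q.value = 0) : ∃ N : ℕ, (fun y : FormalRep => of piRep * y)^[N] (of q) ∈ relations := by
  by_cases hP : diagAltm q₀ P = 0
  · exact fermatHyperbolic_single_of_singleAt ih q₀ q P hP hd hQ hf h0
  · exact h q P hP hd hQ hf h0

/-- Worked example (m = 3, `q₀ = 1`): `P = x y − z + 5·xyz + 5·x²y²z²` has pure-diagonal functional `−5 + 5 = 0`. [folklore] -/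
example : diagAltm 1 (X 0 * X 1 - X 2 + C 5 * (monomial (ones 3) (1:ℚ)) + C 5 * (monomial (ones 3) (1:ℚ)) ^ 2
    : MvPolynomial (Fin 3) ℚ) = 0 := by
  have hxy : (X 0 * X 1 : MvPolynomial (Fin 3) ℚ) = monomial (Finsupp.single 0 1 + Finsupp.single 1 1) 1 := by
    rw [X, X, monomial_mul, one_mul]
  have hz : (X 2 : MvPolynomial (Fin 3) ℚ) = monomial (Finsupp.single 2 1) 1 := rfl
  have h1 : diagAltm 1 (X 0 * X 1 : MvPolynomial (Fin 3) ℚ) = 0 := by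
    rw [hxy]; exact diagAltm_monomial_of_ne 1 _ 1 0 2 (by simp)
  have h2 : diagAltm 1 (X 2 : MvPolynomial (Fin 3) ℚ) = 0 := by
    rw [hz]; exact diagAltm_monomial_of_ne 1 _ 1 2 0 (by simp)
  rw [diagAltm_add, diagAltm_add, sub_eq_add_neg, diagAltm_add, ← neg_one_smul ℚ (X 2 : MvPolynomial (Fin 3) ℚ),
    diagAltm_smul, ← smul_eq_C_mul, ← smul_eq_C_mul, diagAltm_smul, diagAltm_smul, h1, h2,
    ← pow_one (monomial (ones 3) (1:ℚ) : MvPolynomial (Fin 3) ℚ), ← pow_mul, diagAltm_U_pow, diagAltm_U_pow]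
  norm_num

end FermatHyperbolic

/-! ## §10 (v6) TRANSPORT of exactness along polynomial substitutions; x-LINEAR denominators `c·y·x + A(y)`

Exactness of `P dx∧dy/Q` is intrinsic, so it can be checked in any polynomial coordinate system: for a substitution
`φ = aeval f` (`f : Fin 2 → ℚ[x,y]`) the pullback of an `s`-certificate `(G₀, G₁)` for `(P, Q)` is the `s`-certificate
`(φG₀·∂_y f₁ − φG₁·∂_y f₀, φG₁·∂_x f₀ − φG₀·∂_x f₁)` for `(φP · Jac f, φQ)` (`drExact_transport`, via the chain rule
`pderiv_aeval_eq_sum` and `pderiv_comm`). SHEARS `x ↦ x + A(y)` have Jacobian 1 and transport the hyperbola class of §8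
onto ALL x-linear denominators with leading coefficient `c·y`: `Q = c·(a₀ + (x + A₁(y))·y) = c·x·y + c·(a₀ + y·A₁(y))`
(`a₀ ≠ 0` for zero-freeness) — which, up to the swap `x ↔ y` (`drExact_rename_equiv`), is EVERY denominator of the census's
`π²` value class (`1+xy`, `1−x+x²+2xy`, `1−x+x²+xy`, `1+2xy+y²`, `1+xy+y²`, `1+y+xy+y²`; census-m2-v1) and of its
`π² + log² + Li₂` classes with `B = y` (`1+y+xy`, `2+y+xy`). Functional: `P ↦ diagAlt a₀ (P(x − A₁(y), y))`. -/

/-- **Chain rule** for `pderiv` along `aeval`. [folklore] -/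
theorem pderiv_aeval_eq_sum {m m' : ℕ} (f : Fin m → MvPolynomial (Fin m') ℚ) (i : Fin m')
    (F : MvPolynomial (Fin m) ℚ) :
    pderiv i (aeval f F) = ∑ j, aeval f (pderiv j F) * pderiv i (f j) := by
  induction F using MvPolynomial.induction_on with
  | C a => simp [MvPolynomial.algebraMap_eq]
  | add p q hp hq => simp only [map_add, hp, hq, add_mul, Finset.sum_add_distrib]
  | mul_X p k h =>
    have hX : ∀ j : Fin m, aeval f (pderiv j (X k : MvPolynomial (Fin m) ℚ)) * pderiv i (f j)
        = if j = k then pderiv i (f k) else 0 := by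
      intro j
      by_cases hjk : j = k
      · subst hjk; simp
      · rw [pderiv_X_of_ne (Ne.symm hjk), map_zero, zero_mul, if_neg hjk]
    have hsplit : ∀ j : Fin m, aeval f (pderiv j (p * X k)) * pderiv i (f j)
        = f k * (aeval f (pderiv j p) * pderiv i (f j))
          + aeval f p * (aeval f (pderiv j (X k : MvPolynomial (Fin m) ℚ)) * pderiv i (f j)) := by
      intro j
      simp only [Derivation.leibniz, smul_eq_mul, map_add, map_mul, aeval_X]
      ring
    simp_rw [hsplit, Finset.sum_add_distrib, ← Finset.mul_sum, ← h, hX, Finset.sum_ite_eq', Finset.mem_univ,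
      if_true, map_mul, aeval_X, Derivation.leibniz, smul_eq_mul]
    ring

end Summit.KontsevichZagierPeriods.RootDecompRationalCubeDichotomy.Rung26322.RankDescent
end
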